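import Summits.AtomisticToContinuum.BoseEinsteinCondensation.Theorems.GaussianDominationCan.Negative.ProductCalculus
import Literature.MathematicalPhysics.QuantumManyBody.CoarseModeRayPOVMFormCore
import Literature.MathematicalPhysics.QuantumManyBody.OneBodyCurrentGain

/-!
# Crux `GaussianDominationCan` — structure of its own operators `P_i`, `Q_S`, `Θ`

Support file (crux disprover, `stmt-AtomisticToContinuum-9479`, route BECThomsonPrinciple).  The
crux's `let`-bound cell average `P_i` (`Negative.cellAvg`), mode projections `Q_S`
(`Negative.modeProj`, a `foldr` with particle `0` OUTERMOST) and `Θ = Σ_{S∋0}|S|^{-1/2}Q_SΦ`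
(`Negative.theta`) satisfy: `P_i² = P_i` (no Fubini needed), `P_i(1 - P_i) = 0`, `Θ` does not
depend on `x₀`, `P_i` preserves continuity (parametric integral over the bounded cell), and
**`P_i` is self-adjoint on continuous functions** (`integral_conj_mul_cellAvg`, exchange of `xᵢ`
with the dummy variable via `measurePreserving_piFinSuccAbove_cellN` and `integral_prod_symm`).
These are steps (P1)–(P3) of the configuration-space `ExcitationMap` vocabulary
(`N⟨Φ, e^{ik·x₀}Θ⟩ = ⟨Φ, a_k†a_0 n̂₀^{-1/2}Φ⟩`, `‖Θ‖² ≤ 1/N`) that both the free-gas instance of the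
crux and any proof of it need.  All [folklore].
-/

noncomputable section

namespace Summit.AtomisticToContinuum.BoseEinsteinCondensation.Theorems.GaussianDominationCan.Negative

open MeasureTheory Literature.MathematicalPhysics.QuantumManyBody.BoseGas
open scoped ENNReal NNReal ComplexConjugate

variable {N : ℕ} {L : ℝ}

/-- `P_i g` does not depend on the `i`-th coordinate. [folklore] -/
theorem cellAvg_update (i : Fin N) (g : Config N → ℂ) (X : Config N) (z : Space) :
    cellAvg N L i g (Function.update X i z) = cellAvg N L i g X := by
  unfold cellAvg
  simp only [Function.update_idem]

/-- **`P_i` is idempotent** (only `∫_cell 1 = L³` is used, no Fubini). [folklore] -/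
theorem cellAvg_cellAvg (hL : 0 < L) (i : Fin N) (g : Config N → ℂ) :
    cellAvg N L i (cellAvg N L i g) = cellAvg N L i g := by
  funext X
  have h : ∀ y, cellAvg N L i g (Function.update X i y) = cellAvg N L i g X :=
    fun y => cellAvg_update i g X y
  show ((L ^ 3)⁻¹ : ℝ) • ∫ y in cell L, cellAvg N L i g (Function.update X i y) = _
  simp_rw [h]
  rw [integral_cell_const hL, Complex.real_smul, ← mul_assoc]
  have hL' : (L : ℂ) ≠ 0 := by exact_mod_cast hL.ne'
  rw [show (((L ^ 3)⁻¹ : ℝ) : ℂ) * (L : ℂ) ^ 3 = 1 by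
    rw [Complex.ofReal_inv, Complex.ofReal_pow, inv_mul_cancel₀ (pow_ne_zero 3 hL')], one_mul]

/-- `P_i (1 - P_i) = 0`. [folklore] -/
theorem cellAvg_sub_cellAvg (hL : 0 < L) (i : Fin N) (g : Config N → ℂ)
    (hint : ∀ X, IntegrableOn (fun y => g (Function.update X i y)) (cell L) volume) :
    cellAvg N L i (g - cellAvg N L i g) = 0 := by
  funext X
  show ((L ^ 3)⁻¹ : ℝ) • ∫ y in cell L, (g - cellAvg N L i g) (Function.update X i y) = 0
  simp only [Pi.sub_apply]
  rw [integral_sub (hint X) ?_, smul_sub]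
  · have h1 := congrFun (cellAvg_cellAvg hL i g) X
    unfold cellAvg at h1 ⊢
    rw [h1, sub_self]
  · simp_rw [cellAvg_update]
    exact integrableOn_const (hs := by rw [volume_cell]; exact ENNReal.pow_ne_top ENNReal.ofReal_ne_top)

/-- The crux's `foldr` starts with particle `0` OUTERMOST: `Q_S = (0 ∈ S ? P₀ : 1 - P₀) ∘ Q'_S`,
`Q'_S` the `foldr` over the particles `1, …, m`. [folklore] -/
theorem modeProj_succ (m : ℕ) (L : ℝ) (S : Finset (Fin (m + 1))) (g : Config (m + 1) → ℂ) :
    modeProj (m + 1) L S g =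
      (fun h => if (0 : Fin (m + 1)) ∈ S then cellAvg (m + 1) L 0 h else h - cellAvg (m + 1) L 0 h)
        (((List.finRange m).map Fin.succ).foldr
          (fun i h => if i ∈ S then cellAvg (m + 1) L i h else h - cellAvg (m + 1) L i h) g) := by
  unfold modeProj
  rw [List.finRange_succ, List.foldr_cons]

/-- For `0 ∈ S`, `Q_S g` does not depend on `x₀`. [folklore] -/
theorem modeProj_update_zero {m : ℕ} {S : Finset (Fin (m + 1))} (hS : (0 : Fin (m + 1)) ∈ S)
    (g : Config (m + 1) → ℂ) (X : Config (m + 1)) (z : Space) :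
    modeProj (m + 1) L S g (Function.update X 0 z) = modeProj (m + 1) L S g X := by
  rw [modeProj_succ]
  simp only [if_pos hS]
  exact cellAvg_update 0 _ X z

/-- **`Θ` does not depend on `x₀`** (every `Q_S` with `0 ∈ S` ends with `P₀`). [folklore] -/
theorem theta_update_zero (m : ℕ) (L : ℝ) (ψ : Config (m + 1) → ℂ) (X : Config (m + 1)) (z : Space) :
    theta m L ψ (Function.update X 0 z) = theta m L ψ X := by
  unfold theta
  refine Finset.sum_congr rfl fun S hS => ?_
  rw [Finset.mem_filter] at hS
  rw [modeProj_update_zero hS.2]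


/-- The slice integral `X ↦ ∫_cell g(X; xᵢ ↦ y) dy` is continuous for continuous `g`. [folklore] -/
theorem continuous_setIntegral_update (i : Fin N) {g : Config N → ℂ} (hg : Continuous g) :
    Continuous fun X : Config N => ∫ y in cell L, g (Function.update X i y) := by
  have hG : Continuous fun q : Space × Config N => g (Function.update q.2 i q.1) :=
    hg.comp (continuous_snd.update i continuous_fst)
  exact continuous_parametric_setIntegral_of_isBounded (μ := volume) (isBounded_cell L)
    (measurableSet_cell L) hG

/-- `P_i g` is continuous for continuous `g`. [folklore] -/
theorem continuous_cellAvg (i : Fin N) {g : Config N → ℂ} (hg : Continuous g) :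
    Continuous (cellAvg N L i g) := by
  have h := continuous_setIntegral_update (L := L) i hg
  show Continuous fun X : Config N => ((L ^ 3)⁻¹ : ℝ) • ∫ y in cell L, g (Function.update X i y)
  exact (continuous_const (y := ((L ^ 3)⁻¹ : ℝ))).smul h

/-- The slice integral `Y ↦ ∫_cell g(insertNth i x Y) dx` is continuous. [folklore] -/
theorem continuous_setIntegral_insertNth {n : ℕ} (i : Fin (n + 1)) {g : Config (n + 1) → ℂ}
    (hg : Continuous g) :
    Continuous fun Y : Config n => ∫ x in cell L, g (i.insertNth x Y) := by
  have hG : Continuous fun q : Space × Config n => g (i.insertNth q.1 q.2) :=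
    hg.comp (Continuous.finInsertNth (A := fun _ : Fin (n + 1) => Space) i continuous_fst
      continuous_snd)
  exact continuous_parametric_setIntegral_of_isBounded (μ := volume) (isBounded_cell L)
    (measurableSet_cell L) hG

/-- **`P_i` is self-adjoint on continuous functions** (exchange of `xᵢ` with the dummy variable):
`∫ conj(f) · P_i g = ∫ conj(P_i f) · g` over `cell^N`. [folklore] -/
theorem integral_conj_mul_cellAvg {n : ℕ} (i : Fin (n + 1)) {f g : Config (n + 1) → ℂ}
    (hf : Continuous f) (hg : Continuous g) :
    ∫ X in cellN (n + 1) L, conj (f X) * cellAvg (n + 1) L i g X =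
      ∫ X in cellN (n + 1) L, conj (cellAvg (n + 1) L i f X) * g X := by
  set e := MeasurableEquiv.piFinSuccAbove (fun _ : Fin (n + 1) => Space) i with he_def
  set μ : Measure (Space × Config n) := ((volume : Measure Space).restrict (cell L)).prod
    ((volume : Measure (Config n)).restrict (cellN n L)) with hμ
  have he : MeasurePreserving e ((volume : Measure (Config (n + 1))).restrict (cellN (n + 1) L)) μ :=
    measurePreserving_piFinSuccAbove_cellN (n := n) i L
  have hes : ∀ p : Space × Config n, e.symm p = i.insertNth p.1 p.2 := fun _ => rfl
  set c : ℝ := (L ^ 3)⁻¹ with hc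
  set Fbar : Config n → ℂ := fun Y => ∫ x in cell L, f (i.insertNth x Y) with hFbar
  set Gbar : Config n → ℂ := fun Y => ∫ x in cell L, g (i.insertNth x Y) with hGbar
  have hFc : Continuous Fbar := continuous_setIntegral_insertNth i hf
  have hGc : Continuous Gbar := continuous_setIntegral_insertNth i hg
  have hPg : ∀ p : Space × Config n, cellAvg (n + 1) L i g (e.symm p) = c • Gbar p.2 := by
    intro p; rw [hes]; unfold cellAvg; simp only [Fin.update_insertNth]; rfl
  have hPf : ∀ p : Space × Config n, cellAvg (n + 1) L i f (e.symm p) = c • Fbar p.2 := by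
    intro p; rw [hes]; unfold cellAvg; simp only [Fin.update_insertNth]; rfl
  -- continuity of the composite integrands on configuration space
  have hrem : Continuous fun X : Config (n + 1) => (fun j : Fin n => X (i.succAbove j)) :=
    continuous_pi fun j => continuous_apply _
  -- transport the two integrals to the product space
  have hLHS := (he.symm e).integral_comp' (fun X => conj (f X) * cellAvg (n + 1) L i g X)
  have hRHS := (he.symm e).integral_comp' (fun X => conj (cellAvg (n + 1) L i f X) * g X)
  rw [← hLHS, ← hRHS]
  simp only [hPg, hPf]
  simp only [hes]
  -- integrability on the product
  have hint1 : Integrable (fun p : Space × Config n =>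
      conj (f (i.insertNth p.1 p.2)) * (c • Gbar p.2)) μ := by
    have hc1 : Continuous (fun X : Config (n + 1) =>
        conj (f X) * (c • Gbar (fun j : Fin n => X (i.succAbove j)))) :=
      (Complex.continuous_conj.comp hf).mul ((hGc.comp hrem).const_smul c)
    have h2 := integrableOn_cellN hc1 L
    have h3 := ((he.symm e).integrable_comp_emb e.symm.measurableEmbedding).mpr h2
    refine h3.congr (Filter.Eventually.of_forall fun p => ?_)
    simp only [Function.comp_apply, hes, Fin.insertNth_apply_succAbove]
  have hint2 : Integrable (fun p : Space × Config n =>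
      conj (c • Fbar p.2) * g (i.insertNth p.1 p.2)) μ := by
    have hc2 : Continuous (fun X : Config (n + 1) =>
        conj (c • Fbar (fun j : Fin n => X (i.succAbove j))) * g X) :=
      (Complex.continuous_conj.comp ((hFc.comp hrem).const_smul c)).mul hg
    have h2 := integrableOn_cellN hc2 L
    have h3 := ((he.symm e).integrable_comp_emb e.symm.measurableEmbedding).mpr h2
    refine h3.congr (Filter.Eventually.of_forall fun p => ?_)
    simp only [Function.comp_apply, hes, Fin.insertNth_apply_succAbove]
  rw [integral_prod_symm _ hint1, integral_prod_symm _ hint2]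
  refine integral_congr_ae (Filter.Eventually.of_forall fun Y => ?_)
  simp only
  rw [integral_mul_const, integral_const_mul, integral_conj]
  show conj (Fbar Y) * (c • Gbar Y) = conj (c • Fbar Y) * Gbar Y
  rw [Complex.real_smul, Complex.real_smul, map_mul, Complex.conj_ofReal]
  ring


end Summit.AtomisticToContinuum.BoseEinsteinCondensation.Theorems.GaussianDominationCan.Negative

end
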